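import Literature.MathematicalPhysics.QuantumFieldTheory.Balaban1983to89.B12FaddeevPopov016
import Literature.MathematicalPhysics.QuantumFieldTheory.Balaban1983to89.BlockAveragingTwoLevel

/-!
# `Balaban1983to89.B12FaddeevPopov016TwoLevel` — [Balaban1987RG1] (0.16) p. 255 for the CONCRETE averaged contour
variables (0.11): the two standing side conditions of `B12FaddeevPopov016.fp016_of_fineInvariant` discharged

HONEST FRAMING (cell `lit-balaban`, verbatim): statement-level skeleton of published theorems with citation tags; proofs where landed; nothing here is a claim about the Yang–Mills mass gap.

CITATION HEADER.  T. Bałaban, *Renormalization group approach to lattice gauge field theories. I. Generation of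
effective actions in a small field approximation and a coupling constant renormalization in four dimensions*,
Commun. Math. Phys. **109** (1987) 249–301, doi:10.1007/bf01215223 [Balaban1987RG1] (cell paper B12; held text
`paper:balaban1987-cmp109-rg-i-small-field`, journal page = PDF page + 248; displays read from the page renders
`b2b-balaban-ref1/pages/1987-cmp109-rg-I-small-field/…-p005-x2.png` (p. 253), `…-p006-x2.png` (p. 254) and
`…-p007-x2.png` (p. 255)).  Unit `lit-balaban-r09` gen 2 (Phase 2, PHASE2-TARGETS §G seat p07), SKELETON row
`B12.Eq0.16` (decl of record `B12FaddeevPopov016.FP016` / `fp016_of_fineInvariant`, p239083).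

WHAT IS PRINTED (verbatim, p. 255).  *«We introduce (0.15) under the integral in (0.13) and we apply the usual
Faddeev-Popov procedure, i.e. we change the order of integrations and apply the gauge transformation U → U^{u⁻¹} with
u(y) = 1 for y ∈ T⁽¹⁾. By the gauge invariance with respect to such transformations the integrand does not depend on
u and the integral over u is equal to 1. Thus we get
(Tρ)(V) = ∫dU t(V,U) Π_{y∈T⁽¹⁾} Π_{x∈B(y),x≠y} (1/z) exp[−(1/α)[1 − Re tr U(y,x)]] χ({|U(y,x) − 1| < ε₀}) ρ(U). (0.16)»*
with, p. 253, *«U(y, x) = M({U(Γ)}_{Γ ∈ G(y,x)}). (0.11)»* and, p. 255 l. 1, *«where z is defined by the last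
integral»* of (0.15).

WHAT THIS MODULE PROVES.  `B12FaddeevPopov016.fp016_of_fineInvariant` (p239083) proves (0.16) for an ABSTRACT
`Setup.ContourData` under two side conditions print leaves implicit: (a) measurability of `U ↦ U(y,x)`, (b) `z ≠ 0`.
Here both are DISCHARGED for the concrete averaged contour variables (0.11) of the tree,
`BlockAveragingTwoLevel.contourData 𝓜` (the staircase families `G(y,x)` of p. 252 averaged by an axiomatic group
average `M` = `Setup.GroupAverage`, (0.5)–(0.7)):
* `measurable_cVar`, `measurable_holTo` — (a): `U(y,x)` is a finite composition of coordinate evaluations, products,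
  inverses (`BlockAveragingTwoLevel.measurable_stairHol`), the guard `Adm` is a measurable set
  (`BlockAveragingTwoLevel.measurableSet_adm`) and `M` is measurable at each arity (hypothesis `hM`, discharged
  outright for the tree's concrete `su2GroupMean`);
* `fp016_contourData` — (0.16) for `contourData 𝓜` over any `RegularGaugeGroup` with `z ≠ 0`;
* `zNorm_unitaryGroup_pos`, `zNorm_specialUnitaryGroup_pos` — (b): `z > 0` on `U(N)` and `SU(N)` for `α > 0`,
  `ε₀ > 0`, from the tree's Laplace lower bounds `B16ZLower.zNorm_unitaryGroup_ge` /
  `zNorm_specialUnitaryGroup_ge` (radius `ε₀/2`);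
* `fp016_contourData_unitaryGroup`, `fp016_contourData_specialUnitaryGroup` — (0.16) on `U(N)`, `SU(N)` with NO
  residual side condition beyond the printed hypotheses (fine-gauge-invariant kernel, `α > 0`, `ε₀ > 0`) and the
  measurability of `M`;
* `fp016_su2` — (0.16) on `SU(2)` for the tree's concrete inner average `su2GroupMean` (quaternionic projected mean),
  hypothesis-free except for the printed invariance of the kernel.
Nothing else of the paper is asserted; no new `Prop` fact; axioms standard.  DIVERGENCES inherited from the carriers
(cell `pub-balaban` F4/F6/F7; `BlockAveragingTwoLevel` module docstring (a)–(b): the family is indexed by all `d!`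
orderings of the axes and carries ONE gauge-invariant admissibility guard with a single-staircase fallback).
-/

namespace Literature.MathematicalPhysics.QuantumFieldTheory.Balaban1983to89.B12FaddeevPopov016TwoLevel

open _root_.MeasureTheory
open Literature.MathematicalPhysics.QuantumFieldTheory.Balaban1983to89
open BlockAveragingTwoLevel B12FaddeevPopov016

noncomputable section

/-! ## 1. Side condition (a): measurability of the averaged contour variables (0.11) -/

section Measurability

variable {P : Params} {j : ℕ} {G : Type*} [GaugeGroup G] [MeasurableSpace G] [RegularGaugeGroup G]
variable (𝓜 : GroupAverage G)

/-- The averaged contour variable `U(y, x) = M({U(Γ)}_{Γ ∈ G(y,x)})` (0.11) is measurable in `U` when the group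
average `M` is measurable at each arity (the staircase transporters `U(Γ)` are finite products of coordinates).
[cite: Balaban1987RG1, (0.11) p.253] -/
theorem measurable_cVar (hM : ∀ n, Measurable (fun W : Fin (n+1) → G => 𝓜.M W))
    (y : Site P (j+1)) (n : Fin P.d → ℤ) :
    Measurable (fun U : GaugeField P j G => cVar 𝓜 U y n) := by
  unfold cVar
  exact (𝓜.measurable_avg hM).comp (measurable_stairHol y n)

/-- **Side condition (a) of `fp016_of_fineInvariant`, DISCHARGED**: for the concrete (0.11) contour data
`BlockAveragingTwoLevel.contourData 𝓜`, `U ↦ U(y,x)` is measurable for every coarse site `y` and fine site `x`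
(measurable guard `Adm`, measurable average on it, measurable single-staircase fallback off it).
[cite: Balaban1987RG1, (0.11) p.253] -/
theorem measurable_holTo (hM : ∀ n, Measurable (fun W : Fin (n+1) → G => 𝓜.M W))
    (y : Site P (j+1)) (x : Site P j) :
    Measurable (fun U : GaugeField P j G => (contourData 𝓜).holTo U y x) := by
  show Measurable (fun U : GaugeField P j G => holTo 𝓜 U y x)
  unfold holTo
  exact Measurable.ite (measurableSet_adm 𝓜 y _) (measurable_cVar 𝓜 hM y _) (T4Continuum.measurable_holAt _)

end Measurability

/-! ## 2. (0.16) for the concrete contour variables over an abstract regular gauge group -/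

section Abstract

variable {P : Params} {j : ℕ} {G : Type*} [GaugeGroup G] [MeasurableSpace G] [HaarData G] [RegularGaugeGroup G]

/-- **(0.16) for the concrete averaged contour variables (0.11).**  For a kernel `t` invariant under the gauge
transformations `u` with `u = 1` on `T⁽¹⁾`, a group average `M` measurable at each arity, `α > 0` and `z ≠ 0`:
`(Tρ)(V) = ∫dU t(V,U) Π_y Π_{x∈B(y),x≠y} (1/z)e^{−(1/α)[1 − Re tr U(y,x)]}χ({|U(y,x) − 1| < ε₀}) ρ(U)` for every
fine-gauge-invariant density `ρ` integrable against the kernel, with `U(y,x)` THE (0.11) variables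
`BlockAveragingTwoLevel.contourData 𝓜` — `B12FaddeevPopov016.fp016_of_fineInvariant` with its measurability side
condition discharged by `measurable_holTo`. [cite: Balaban1987RG1, (0.16) p.255] -/
theorem fp016_contourData (hj : j + 1 ≤ P.m + P.K) (k : KernelRT P j G) (hk : k.FineInvariant)
    (𝓜 : GroupAverage G) (hM : ∀ n, Measurable (fun W : Fin (n+1) → G => 𝓜.M W))
    {α ε₀ : ℝ} (hα : 0 < α) (hz : B16ZLower.zNorm G α ε₀ ≠ 0) :
    FP016 k (contourData 𝓜) α ε₀ :=
  fp016_of_fineInvariant hj k hk (contourData 𝓜) (fun y x => measurable_holTo 𝓜 hM y x) hα hz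

end Abstract

/-! ## 3. Side condition (b): `z > 0` on `U(N)` and `SU(N)`; (0.16) there -/

section Unitary

variable {P : Params} {j : ℕ} {N : ℕ} [NeZero N]

/-- **Side condition (b), DISCHARGED on `U(N)`**: the normalisation `z` of (0.15) is `> 0` for `α > 0`, `ε₀ > 0`
(Laplace lower bound `B16ZLower.zNorm_unitaryGroup_ge` on the ball of radius `ε₀/2`).
[cite: Balaban1987RG1, (0.15) p.254] -/
theorem zNorm_unitaryGroup_pos {α ε₀ : ℝ} (hα : 0 < α) (hε : 0 < ε₀) :
    0 < B16ZLower.zNorm (Matrix.unitaryGroup (Fin N) ℂ) α ε₀ := by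
  have h := B16ZLower.zNorm_unitaryGroup_ge (N := N) hα (half_pos hε) (half_lt_self hε)
  refine lt_of_lt_of_le ?_ h
  have h1 : 0 < ε₀ / 2 / (2 * Real.pi + ε₀ / 2) := by positivity
  positivity

/-- **Side condition (b), DISCHARGED on `SU(N)`**: `z > 0` for `α > 0`, `ε₀ > 0`
(`B16ZLower.zNorm_specialUnitaryGroup_ge` on the ball of radius `ε₀/2`). [cite: Balaban1987RG1, (0.15) p.254] -/
theorem zNorm_specialUnitaryGroup_pos {α ε₀ : ℝ} (hα : 0 < α) (hε : 0 < ε₀) :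
    0 < B16ZLower.zNorm (Matrix.specialUnitaryGroup (Fin N) ℂ) α ε₀ := by
  have h := B16ZLower.zNorm_specialUnitaryGroup_ge (N := N) hα (half_pos hε) (half_lt_self hε)
  refine lt_of_lt_of_le ?_ h
  have h1 : 0 < 4 * Real.pi / ((2 * (N : ℝ) + 1) * (ε₀ / 2)) := by positivity
  have h2 : 0 < (ε₀ / 2 / (16 * Real.pi + ε₀ / 2)) ^ (N * N) := by positivity
  positivity

/-- **(0.16) on `G = U(N)`** for the concrete contour variables (0.11): no residual side condition beyond the
printed hypotheses (kernel invariant under `u` with `u = 1` on `T⁽¹⁾`; `α > 0`, `ε₀ > 0`) and the measurability of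
the group average `M` at each arity. [cite: Balaban1987RG1, (0.16) p.255] -/
theorem fp016_contourData_unitaryGroup (hj : j + 1 ≤ P.m + P.K)
    (k : KernelRT P j (Matrix.unitaryGroup (Fin N) ℂ)) (hk : k.FineInvariant)
    (𝓜 : GroupAverage (Matrix.unitaryGroup (Fin N) ℂ))
    (hM : ∀ n, Measurable (fun W : Fin (n+1) → Matrix.unitaryGroup (Fin N) ℂ => 𝓜.M W))
    {α ε₀ : ℝ} (hα : 0 < α) (hε : 0 < ε₀) :
    FP016 k (contourData 𝓜) α ε₀ :=
  fp016_contourData hj k hk 𝓜 hM hα (zNorm_unitaryGroup_pos hα hε).ne'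

/-- **(0.16) on `G = SU(N)`** for the concrete contour variables (0.11) (same hypotheses as on `U(N)`).
[cite: Balaban1987RG1, (0.16) p.255] -/
theorem fp016_contourData_specialUnitaryGroup (hj : j + 1 ≤ P.m + P.K)
    (k : KernelRT P j (Matrix.specialUnitaryGroup (Fin N) ℂ)) (hk : k.FineInvariant)
    (𝓜 : GroupAverage (Matrix.specialUnitaryGroup (Fin N) ℂ))
    (hM : ∀ n, Measurable (fun W : Fin (n+1) → Matrix.specialUnitaryGroup (Fin N) ℂ => 𝓜.M W))
    {α ε₀ : ℝ} (hα : 0 < α) (hε : 0 < ε₀) :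
    FP016 k (contourData 𝓜) α ε₀ :=
  fp016_contourData hj k hk 𝓜 hM hα (zNorm_specialUnitaryGroup_pos hα hε).ne'

end Unitary

/-! ## 4. `SU(2)` with the tree's concrete inner average: (0.16) with no residual hypothesis -/

section SU2

variable {P : Params} {j : ℕ}

/-- **(0.16) on `SU(2)`, hypothesis-free instance**: for the averaged contour variables (0.11) built with the tree's
concrete group average `su2GroupMean` (the quaternionic projected mean; (0.5)–(0.7) on families of diameter `< 1`),
every kernel transformation (0.13) with a kernel invariant under the fine gauge transformations satisfies (0.16),
for all `α > 0`, `ε₀ > 0`. [cite: Balaban1987RG1, (0.16) p.255] -/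
theorem fp016_su2 (hj : j + 1 ≤ P.m + P.K)
    (k : KernelRT P j (Matrix.specialUnitaryGroup (Fin 2) ℂ)) (hk : k.FineInvariant)
    {α ε₀ : ℝ} (hα : 0 < α) (hε : 0 < ε₀) :
    FP016 k (contourData su2GroupMean) α ε₀ :=
  fp016_contourData_specialUnitaryGroup hj k hk su2GroupMean measurable_su2GroupMean_M hα hε

end SU2

end

end Literature.MathematicalPhysics.QuantumFieldTheory.Balaban1983to89.B12FaddeevPopov016TwoLevel
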